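import Summits.AtomisticToContinuum.Crystallization.Theorems.SquareWellLayerCakeGapTwelveToBarlowCombinatorialLayeringTransportSteps1
import Summits.AtomisticToContinuum.Crystallization.Theorems.SquareWellLayerCakeGapTwelveToBarlowCombinatorialLayeringTransportSteps2
import Summits.AtomisticToContinuum.Crystallization.Theorems.SquareWellLayerCakeGapTwelveToBarlowCombinatorialLayeringTransportSteps6
import Summits.AtomisticToContinuum.Crystallization.Theorems.SquareWellLayerCakeGapTwelveToBarlowCombinatorialLayeringTransportVinv

/-!
# Combinatorial layering (B1a of `GapTwelveToBarlow`): transport port, part `Attach1`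

Crux `SquareWellLayerCake.GapTwelveToBarlow` (stmt-AtomisticToContinuum-15807), line `Sketch`,
stub `stub_combinatorialLayering`, residual `(H_develop)`.  PORT of the tree file
`PalmUnimodularRigidityShellsToBarlowChartTransportAttach1.lean` (crux 9227) to GRADED COMBINATORIAL
charts, following the port rules recorded in `…CombinatorialLayeringTransportSteps1` (bundled
standing hypothesis `hch` on `S : ℕ → Set E3`, abstract bond relation `B`, memberships
`x ∈ S (n + k)`, transfer as an input).  Statements and proofs are otherwise those of the source,
whose documentation follows.

# Line `develop-the-model-growth-descent` (crux `ShellsToBarlowChart`, stmt-AtomisticToContinuum-9227): swap symmetry and the attachment of transported caps (part 1/2)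

Helper lemmas for `stub_transportSystem` (the geometric half of the line): frames `⟨x, t₁, t₂, U⟩`
read in the integer charts `IsZChart` of a good-shell configuration, their transports and the
coherence of the resulting development `frameAt`.  The only metric inputs are the chart transfer
lemma and `bond_nb_iff`; everything else is label combinatorics in `ℤ³` (pattern facts
`TransportPatterns*`).  All `[folklore]` (HalesDSP2012 §1.3 for the two kissing patterns).
-/

noncomputable section

namespace Summit.AtomisticToContinuum.Crystallization.Theorems.SquareWellLayerCakeGapTwelveToBarlow

open Literature.Geometry.DiscreteGeometry Literature.MathematicalPhysics.StatisticalMechanics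
open Summit.AtomisticToContinuum.Crystallization.Theorems.PalmUnimodularRigidityShellsToBarlowChart hiding
  IsZChart TransportSystem scales_tied sqNormInt_transfer bond_symm nb_mem zlab_spec zlab_nb
  bond_nb_iff pattern_cases transfer_nb_nb transfer_nb_centre transfer_nb_target
  sqNormInt_zlab_centre hcp_of_mirror_pair Istep_spec Jstep_spec IinvStep_spec JinvStep_spec
  capWithAny_of_mem_cap IinvStep_Istep Istep_IinvStep JinvStep_Jstep Jstep_JinvStep polar_at_apex
  onesided_at_apex Vstep_spec nb_inj Istep_lower Jstep_lower IinvStep_lower JinvStep_lower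
  polar_at_lower_apex onesided_at_lower_apex VinvStep_spec attach_I_even attach_I_odd
  attach_lower_I_pos attach_lower_I_neg attach_J_even attach_J_odd Vstep_Istep_pt Vstep_Istep_back
  Vstep_Istep_side Vstep_Jstep_pt Vstep_Istep_comm Vstep_Jstep_comm attach_lower_J_pos
  attach_lower_J_neg VinvStep_Istep_pt VinvStep_Jstep_pt VinvStep_Istep_back VinvStep_Istep_side
  VinvStep_Istep_comm VinvStep_Jstep_comm Istep_Jstep_comm

variable {S : ℕ → Set (EuclideanSpace ℝ (Fin 3))}
  {B : EuclideanSpace ℝ (Fin 3) → EuclideanSpace ℝ (Fin 3) → Prop}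
  {Pc : EuclideanSpace ℝ (Fin 3) → Finset (Fin 3 → ℤ)}
  {nb : EuclideanSpace ℝ (Fin 3) → (Fin 3 → ℤ) → EuclideanSpace ℝ (Fin 3)}

variable
  (hch : (∀ n : ℕ, ∀ z ∈ S n, (Pc z = fcc3Int ∨ Pc z = hcpInt) ∧
      Set.BijOn (nb z) (↑(Pc z) : Set (Fin 3 → ℤ)) {y | B z y} ∧
      ∀ t ∈ Pc z, ∀ t' ∈ Pc z, (B (nb z t) (nb z t') ↔ sqNormInt (t - t') = 18)) ∧
    (∀ n : ℕ, ∀ z ∈ S (n + 1), ∀ y, B z y → y ∈ S n) ∧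
    (∀ n m : ℕ, ∀ x ∈ S n, ∀ y ∈ S m, B x y →
      ∀ (z z' : EuclideanSpace ℝ (Fin 3)) (t t' u u' : Fin 3 → ℤ),
        (t = 0 ∧ z = x ∨ t ∈ Pc x ∧ z = nb x t) → (t' = 0 ∧ z' = x ∨ t' ∈ Pc x ∧ z' = nb x t') →
        (u = 0 ∧ z = y ∨ u ∈ Pc y ∧ z = nb y u) → (u' = 0 ∧ z' = y ∨ u' ∈ Pc y ∧ z' = nb y u') →
        sqNormInt (u - u') = sqNormInt (t - t')) ∧
    (∀ x y, B x y → B y x))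

include hch


/-- **Upper attachment across I, even layer**: the apex site `nb x c` of an even frame is the
neighbour of `Ix` labelled `c₊ − t₁₊` (`c₊` the apex of the transported cap): in the model,
`(k+1, i, j)` is the upper neighbour of `(k, i+1, j)` with offset `(1, 0)`. [folklore] -/
theorem attach_I_even {n : ℕ} {x : (EuclideanSpace ℝ (Fin 3))}
    (hx : x ∈ S (n + 1)) {t₁ t₂ : Fin 3 → ℤ} {U : Finset (Fin 3 → ℤ)} (hU : IsFrame (Pc x) t₁ t₂ U)
    (hpar : frameParity t₁ t₂ U = 1)
    (hreg : Pc (nb x t₁) = fcc3Int ∨ Pc x = hcpInt ∨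
      (-zlab Pc nb (nb x t₁) x ∈ Pc (nb x t₁) ∧ -zlab Pc nb (nb x t₁) (nb x t₂) ∈ Pc (nb x t₁))) :
    nb (nb x t₁) (apexOf (Istep Pc nb ⟨x, t₁, t₂, U⟩).t₁ (Istep Pc nb ⟨x, t₁, t₂, U⟩).t₂
        (Istep Pc nb ⟨x, t₁, t₂, U⟩).U - (Istep Pc nb ⟨x, t₁, t₂, U⟩).t₁) = nb x (apexOf t₁ t₂ U) ∧
    zlab Pc nb (nb x t₁) (nb x (apexOf t₁ t₂ U)) =
      apexOf (Istep Pc nb ⟨x, t₁, t₂, U⟩).t₁ (Istep Pc nb ⟨x, t₁, t₂, U⟩).t₂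
        (Istep Pc nb ⟨x, t₁, t₂, U⟩).U - (Istep Pc nb ⟨x, t₁, t₂, U⟩).t₁ := by
  obtain ⟨hyS, -, -, -, -, -, -, -, -, -, -, hframe, hparI, c₁, hc₁U, -, hfilt, hbu, -, -, hfiltU⟩ :=
    Istep_spec hch hx hU hreg
  have hPx := pattern_cases hch hx
  have hPy := pattern_cases hch hyS
  obtain ⟨h12, hhex, -, -, -⟩ := id hU
  have ht₁ : t₁ ∈ Pc x := hhex (mem_hexLabels_iff.2 (Or.inl rfl))
  have ht₂ : t₂ ∈ Pc x := hhex (mem_hexLabels_iff.2 (Or.inr (Or.inl rfl)))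
  obtain ⟨hcU, hcP, hc, hc1, hc2, hE⟩ := even_form_of_parity hPx hU hpar
  set c := apexOf t₁ t₂ U with hc_def
  have hc₁ : c₁ = c := by
    have h1 := (filter_evenCap (Pc x) hPx t₁ ht₁ t₂ ht₂ c hcP h12 hhex hc hc1 hc2).1
    rw [← hE, hfilt] at h1
    exact Finset.singleton_injective h1
  rw [hc₁] at hbu hfiltU
  have hμ := zlab_spec hch hyS (nb_mem hch hx hcP).1 hbu
  -- the transported cap is even with apex `c'`
  have hpar' := hparI.trans hpar
  set a' := (Istep Pc nb ⟨x, t₁, t₂, U⟩).t₁ with ha'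
  set b' := (Istep Pc nb ⟨x, t₁, t₂, U⟩).t₂ with hb'
  set U' := (Istep Pc nb ⟨x, t₁, t₂, U⟩).U with hU'
  obtain ⟨h12', hhex', -, -, -⟩ := id hframe
  have ha'P : a' ∈ Pc (nb x t₁) := hhex' (mem_hexLabels_iff.2 (Or.inl rfl))
  have hb'P : b' ∈ Pc (nb x t₁) := hhex' (mem_hexLabels_iff.2 (Or.inr (Or.inl rfl)))
  obtain ⟨-, hc'P, hc', hc1', hc2', hE'⟩ := even_form_of_parity hPy hframe hpar'
  set c' := apexOf a' b' U' with hc'_def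
  have hμeq : zlab Pc nb (nb x t₁) (nb x c) = c' - a' := by
    have h1 := (filter_evenCap (Pc (nb x t₁)) hPy a' ha'P b' hb'P c' hc'P h12' hhex' hc' hc1' hc2').2.2.1
    rw [← hE', hfiltU] at h1
    exact Finset.singleton_injective h1
  refine ⟨?_, hμeq⟩
  rw [← hμeq]; exact hμ.2

/-- **Upper attachment across I, odd layer**: the apex site of `Ix` is the neighbour of `x`
labelled `c + t₁`: in the model, `(k+1, i+1, j)` is an upper neighbour of `(k, i, j)`.
[folklore] -/
theorem attach_I_odd {n : ℕ} {x : (EuclideanSpace ℝ (Fin 3))}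
    (hx : x ∈ S (n + 1)) {t₁ t₂ : Fin 3 → ℤ} {U : Finset (Fin 3 → ℤ)} (hU : IsFrame (Pc x) t₁ t₂ U)
    (hpar : frameParity t₁ t₂ U = -1)
    (hreg : Pc (nb x t₁) = fcc3Int ∨ Pc x = hcpInt ∨
      (-zlab Pc nb (nb x t₁) x ∈ Pc (nb x t₁) ∧ -zlab Pc nb (nb x t₁) (nb x t₂) ∈ Pc (nb x t₁))) :
    nb (nb x t₁) (apexOf (Istep Pc nb ⟨x, t₁, t₂, U⟩).t₁ (Istep Pc nb ⟨x, t₁, t₂, U⟩).t₂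
        (Istep Pc nb ⟨x, t₁, t₂, U⟩).U) = nb x (apexOf t₁ t₂ U + t₁) ∧
    zlab Pc nb (nb x t₁) (nb x (apexOf t₁ t₂ U + t₁)) =
      apexOf (Istep Pc nb ⟨x, t₁, t₂, U⟩).t₁ (Istep Pc nb ⟨x, t₁, t₂, U⟩).t₂
        (Istep Pc nb ⟨x, t₁, t₂, U⟩).U := by
  obtain ⟨hyS, -, -, -, -, -, -, -, -, -, -, hframe, hparI, c₁, hc₁U, -, hfilt, hbu, -, -, hfiltU⟩ :=
    Istep_spec hch hx hU hreg
  have hPx := pattern_cases hch hx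
  have hPy := pattern_cases hch hyS
  obtain ⟨h12, hhex, -, -, -⟩ := id hU
  have ht₁ : t₁ ∈ Pc x := hhex (mem_hexLabels_iff.2 (Or.inl rfl))
  have ht₂ : t₂ ∈ Pc x := hhex (mem_hexLabels_iff.2 (Or.inr (Or.inl rfl)))
  obtain ⟨hcU, hcP, hc, hc1, hc2, hO⟩ := odd_form_of_parity hPx hU hpar
  set c := apexOf t₁ t₂ U with hc_def
  have hc₁ : c₁ = c + t₁ := by
    have h1 := (filter_oddCap (Pc x) hPx t₁ ht₁ t₂ ht₂ c hcP h12 hhex hc hc1 hc2).1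
    rw [← hO, hfilt] at h1
    exact Finset.singleton_injective h1
  rw [hc₁] at hbu hfiltU
  have hμ := zlab_spec hch hyS (nb_mem hch hx hc1).1 hbu
  have hpar' := hparI.trans hpar
  set a' := (Istep Pc nb ⟨x, t₁, t₂, U⟩).t₁ with ha'
  set b' := (Istep Pc nb ⟨x, t₁, t₂, U⟩).t₂ with hb'
  set U' := (Istep Pc nb ⟨x, t₁, t₂, U⟩).U with hU'
  obtain ⟨h12', hhex', -, -, -⟩ := id hframe
  have ha'P : a' ∈ Pc (nb x t₁) := hhex' (mem_hexLabels_iff.2 (Or.inl rfl))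
  have hb'P : b' ∈ Pc (nb x t₁) := hhex' (mem_hexLabels_iff.2 (Or.inr (Or.inl rfl)))
  obtain ⟨-, hc'P, hc', hc1', hc2', hO'⟩ := odd_form_of_parity hPy hframe hpar'
  set c' := apexOf a' b' U' with hc'_def
  have hμeq : zlab Pc nb (nb x t₁) (nb x (c + t₁)) = c' := by
    have h1 := (filter_oddCap (Pc (nb x t₁)) hPy a' ha'P b' hb'P c' hc'P h12' hhex' hc' hc1' hc2').2.2.1
    rw [← hO', hfiltU] at h1
    exact Finset.singleton_injective h1
  refine ⟨?_, hμeq⟩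
  rw [← hμeq]; exact hμ.2

omit hch in
/-! ## Registered anchor (closed form) -/

omit hch in
/-- **Closed form of `attach_I_even`** (the registered anchor of this file): the section data
`S, B, Pc, nb` and the standing hypothesis written out (two hypotheses regrouped). [folklore] -/
theorem attach_I_even_graded :
    ∀ {S : ℕ → Set (EuclideanSpace ℝ (Fin 3))} {B : EuclideanSpace ℝ (Fin 3) → EuclideanSpace ℝ
    (Fin 3) → Prop} {Pc : EuclideanSpace ℝ (Fin 3) → Finset (Fin 3 → ℤ)} {nb : EuclideanSpace ℝ
    (Fin 3) → (Fin 3 → ℤ) → EuclideanSpace ℝ (Fin 3)}, ((∀ n : ℕ, ∀ z ∈ S n, (Pc z =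
    Summit.AtomisticToContinuum.Crystallization.Theorems.PalmUnimodularRigidityShellsToBarlowChart.fcc3Int
    ∨ Pc z = Literature.Geometry.DiscreteGeometry.hcpInt) ∧ Set.BijOn (nb z) (↑(Pc z) : Set (Fin
    3 → ℤ)) {y | B z y} ∧ ∀ t ∈ Pc z, ∀ t' ∈ Pc z, (B (nb z t) (nb z t') ↔
    Literature.Geometry.DiscreteGeometry.sqNormInt (t - t') = 18)) ∧ (∀ n : ℕ, ∀ z ∈ S (n + 1),
    ∀ y, B z y → y ∈ S n) ∧ (∀ n m : ℕ, ∀ x ∈ S n, ∀ y ∈ S m, B x y → ∀ (z z' : EuclideanSpace ℝ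
    (Fin 3)) (t t' u u' : Fin 3 → ℤ), (t = 0 ∧ z = x ∨ t ∈ Pc x ∧ z = nb x t) → (t' = 0 ∧ z' = x
    ∨ t' ∈ Pc x ∧ z' = nb x t') → (u = 0 ∧ z = y ∨ u ∈ Pc y ∧ z = nb y u) → (u' = 0 ∧ z' = y ∨
    u' ∈ Pc y ∧ z' = nb y u') → Literature.Geometry.DiscreteGeometry.sqNormInt (u - u') =
    Literature.Geometry.DiscreteGeometry.sqNormInt (t - t')) ∧ (∀ x y, B x y → B y x)) → ∀ {n :
    ℕ} {x : (EuclideanSpace ℝ (Fin 3))} {t₁ t₂ : Fin 3 → ℤ} {U : Finset (Fin 3 → ℤ)},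
    Summit.AtomisticToContinuum.Crystallization.Theorems.PalmUnimodularRigidityShellsToBarlowChart.IsFrame
    (Pc x) t₁ t₂ U → x ∈ S (n + 1) →
    Summit.AtomisticToContinuum.Crystallization.Theorems.PalmUnimodularRigidityShellsToBarlowChart.frameParity
    t₁ t₂ U = 1 → Pc (nb x t₁) =
    Summit.AtomisticToContinuum.Crystallization.Theorems.PalmUnimodularRigidityShellsToBarlowChart.fcc3Int
    ∨ Pc x = Literature.Geometry.DiscreteGeometry.hcpInt ∨
    (-Summit.AtomisticToContinuum.Crystallization.Theorems.PalmUnimodularRigidityShellsToBarlowChart.zlab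
    Pc nb (nb x t₁) x ∈ Pc (nb x t₁) ∧
    -Summit.AtomisticToContinuum.Crystallization.Theorems.PalmUnimodularRigidityShellsToBarlowChart.zlab
    Pc nb (nb x t₁) (nb x t₂) ∈ Pc (nb x t₁)) → nb (nb x t₁)
    (Summit.AtomisticToContinuum.Crystallization.Theorems.PalmUnimodularRigidityShellsToBarlowChart.apexOf
    (Summit.AtomisticToContinuum.Crystallization.Theorems.PalmUnimodularRigidityShellsToBarlowChart.Istep
    Pc nb ⟨x, t₁, t₂, U⟩).t₁
    (Summit.AtomisticToContinuum.Crystallization.Theorems.PalmUnimodularRigidityShellsToBarlowChart.Istep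
    Pc nb ⟨x, t₁, t₂, U⟩).t₂
    (Summit.AtomisticToContinuum.Crystallization.Theorems.PalmUnimodularRigidityShellsToBarlowChart.Istep
    Pc nb ⟨x, t₁, t₂, U⟩).U -
    (Summit.AtomisticToContinuum.Crystallization.Theorems.PalmUnimodularRigidityShellsToBarlowChart.Istep
    Pc nb ⟨x, t₁, t₂, U⟩).t₁) = nb x
    (Summit.AtomisticToContinuum.Crystallization.Theorems.PalmUnimodularRigidityShellsToBarlowChart.apexOf
    t₁ t₂ U) ∧
    Summit.AtomisticToContinuum.Crystallization.Theorems.PalmUnimodularRigidityShellsToBarlowChart.zlab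
    Pc nb (nb x t₁) (nb x
    (Summit.AtomisticToContinuum.Crystallization.Theorems.PalmUnimodularRigidityShellsToBarlowChart.apexOf
    t₁ t₂ U)) =
    Summit.AtomisticToContinuum.Crystallization.Theorems.PalmUnimodularRigidityShellsToBarlowChart.apexOf
    (Summit.AtomisticToContinuum.Crystallization.Theorems.PalmUnimodularRigidityShellsToBarlowChart.Istep
    Pc nb ⟨x, t₁, t₂, U⟩).t₁
    (Summit.AtomisticToContinuum.Crystallization.Theorems.PalmUnimodularRigidityShellsToBarlowChart.Istep
    Pc nb ⟨x, t₁, t₂, U⟩).t₂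
    (Summit.AtomisticToContinuum.Crystallization.Theorems.PalmUnimodularRigidityShellsToBarlowChart.Istep
    Pc nb ⟨x, t₁, t₂, U⟩).U -
    (Summit.AtomisticToContinuum.Crystallization.Theorems.PalmUnimodularRigidityShellsToBarlowChart.Istep
    Pc nb ⟨x, t₁, t₂, U⟩).t₁ := by
  intro S B Pc nb hch n x t₁ t₂ U hU hx hpar hreg
  exact attach_I_even hch hx hU hpar hreg

end Summit.AtomisticToContinuum.Crystallization.Theorems.SquareWellLayerCakeGapTwelveToBarlow

end
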